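import Summits.Parity.GeneralizedHardyLittlewood.Theses.LeeYangFibres
import Summits.Parity.GeneralizedHardyLittlewood.Theorems.RelativeDimOne.Negative.RelativeDimOneLoadBearingTwo
import Literature.NumberTheory.Sieve.LinearEquationsInPrimesDimOne
import HarnessLib

/-!
# Crux `PrimeCellsRelative` (stmt-Parity-14112): the hypothesis `1 ≤ t` is NOT load-bearing —
# the `t = 0` slice is TRUE

Negative-side support (refuter cdisprove seat), the one piece of SLACK found in the typing. At
`t = 0` (empty system) the cell count of `PrimeCellsRelative` is the number of lattice points of
`K`, the main term is `β_∞(∅, K) · 𝔖(∅) · (A₁(N)/N)^0 = vol K · 1 · 1`, and the allowance is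
`ε (vol K + N / log^0 N) = ε (vol K + N)`; since a convex `K ⊆ [-N, N]` is an interval,
`|#(K ∩ ℤ) − vol K| ≤ 1 ≤ ε N` for `N ≥ 1/ε`. So the slice holds (with `u = 2`), i.e. the guard
`1 ≤ t` of the crux is cosmetic — exactly as for the equivalent node `RelativeDimOne`
(`Theorems.RelativeDimOne.Negative.relativeDimOneAtZero_holds`, whose lemmas `singularProduct_fin_zero`
and `archFactor_fin_zero` are reused). Any counterexample to the crux needs `t ≥ 2` (the `t = 1`
slice is the theorem `Cruxes.PrimeCellsRelative.Sketch.primeCellsRelative_at_one`).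
This file does NOT refute the crux.
-/

noncomputable section

namespace Summit.Parity.GeneralizedHardyLittlewood.Theorems.PrimeCellsRelative.Negative

open scoped BigOperators Topology Classical MeasureTheory
open Filter Set Function MeasureTheory Finset Literature.NumberTheory.Sieve
open Summit.Parity.GeneralizedHardyLittlewood.Theorems.RelativeDimOne.Negative
  (singularProduct_fin_zero archFactor_fin_zero)

/-- **The `t = 0` slice of `PrimeCellsRelative` holds** (so `1 ≤ t` is cosmetic): lattice points of
an interval versus its length, `|# − vol| ≤ 1 ≤ ε (vol K + N)` once `N ≥ 1/ε`; `𝔖(∅) = 1`,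
`β_∞(∅, K) = vol K` (tree: `DimOne.exists_filter_eq_Icc`). [folklore] -/
theorem primeCellsRelative_at_zero :
    ∀ L : ℕ, ∀ ε : ℝ, 0 < ε → ∃ u : ℕ, 2 ≤ u ∧ ∃ N₀ : ℕ, ∀ N : ℕ, N₀ ≤ N →
      ∀ Ψ : Fin 0 → Literature.NumberTheory.Sieve.AffLinForm 1,
        Literature.NumberTheory.Sieve.IsNondegenerateSystem Ψ →
        Literature.NumberTheory.Sieve.affLinSize Ψ N ≤ L →
        ∀ K : Set (Fin 1 → ℝ), Convex ℝ K → K ⊆ Literature.NumberTheory.Sieve.realBox 1 N →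
          |((((Literature.NumberTheory.Sieve.latticeBox 1 N).filter (fun n =>
              Literature.NumberTheory.Sieve.realPoint n ∈ K ∧ ∀ i, (N : ℝ) ^ ((1 : ℝ) / u) <
                (Nat.minFac ((Ψ i).eval n).toNat : ℝ) ∧
                ArithmeticFunction.cardFactors ((Ψ i).eval n).toNat = 1)).card : ℕ) : ℝ) -
            Literature.NumberTheory.Sieve.archFactor Ψ K *
              Literature.NumberTheory.Sieve.singularProduct Ψ *
              (((((Finset.Icc 1 N).filter (fun m => (N : ℝ) ^ ((1 : ℝ) / u) < (Nat.minFac m : ℝ) ∧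
                ArithmeticFunction.cardFactors m = 1)).card : ℕ) : ℝ) / N) ^ 0| ≤
          ε * (Literature.NumberTheory.Sieve.archFactor Ψ K *
              Literature.NumberTheory.Sieve.singularProduct Ψ *
              (((((Finset.Icc 1 N).filter (fun m => (N : ℝ) ^ ((1 : ℝ) / u) < (Nat.minFac m : ℝ) ∧
                ArithmeticFunction.cardFactors m = 1)).card : ℕ) : ℝ) / N) ^ 0 + N / Real.log N ^ 0) := by
  intro L ε hε
  refine ⟨2, le_rfl, ⌈1 / ε⌉₊, fun N hN Ψ _ _ K hK hKN => ?_⟩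
  have hNε : 1 / ε ≤ N := (Nat.le_ceil _).trans (by exact_mod_cast hN)
  have hεN : 1 ≤ ε * N := by
    rw [div_le_iff₀ hε] at hNε
    linarith
  -- the empty conjunction over `Fin 0` is true: the cell is the set of lattice points of `K`
  have hfilter : (Literature.NumberTheory.Sieve.latticeBox 1 N).filter (fun n =>
      Literature.NumberTheory.Sieve.realPoint n ∈ K ∧ ∀ i : Fin 0, (N : ℝ) ^ ((1 : ℝ) / (2 : ℕ)) <
        (Nat.minFac ((Ψ i).eval n).toNat : ℝ) ∧
        ArithmeticFunction.cardFactors ((Ψ i).eval n).toNat = 1) =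
      (Literature.NumberTheory.Sieve.latticeBox 1 N).filter (fun n => realPoint n ∈ K) :=
    Finset.filter_congr fun n _ => by simp
  rw [hfilter, pow_zero, pow_zero, mul_one, div_one, archFactor_fin_zero, singularProduct_fin_zero,
    mul_one, DimOne.card_filter_latticeBox]
  set S : Set ℝ := {r : ℝ | (fun _ : Fin 1 => r) ∈ K} with hSdef
  have hS : S.OrdConnected := (DimOne.convex_slice hK).ordConnected
  have hSN : S ⊆ Set.Icc (-(N : ℝ)) N := by
    intro r hr
    have := hKN hr
    simp only [realBox, Set.mem_Icc, Pi.le_def, Fin.forall_fin_one] at this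
    exact this
  obtain ⟨m₁, m₂, hI, hvol⟩ := DimOne.exists_filter_eq_Icc (N := N) hS hSN
  have hI' : (Finset.Icc (-(N : ℤ)) N).filter (fun m : ℤ => realPoint (fun _ : Fin 1 => m) ∈ K) =
      Finset.Icc m₁ m₂ := by
    rw [← hI]
    rfl
  rw [hI']
  have hvol0 : 0 ≤ (volume S).toReal := ENNReal.toReal_nonneg
  calc |(#(Finset.Icc m₁ m₂) : ℝ) - (volume S).toReal| ≤ 1 := hvol
    _ ≤ ε * N := hεN
    _ ≤ ε * ((volume S).toReal + N) := by nlinarith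

end Summit.Parity.GeneralizedHardyLittlewood.Theorems.PrimeCellsRelative.Negative

end
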